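import Summits.HodgeConjecture.CorCM.B01.Transposition.HComp.HeckeTranslatesOfSec42DataOf
import Literature.NumberTheory.Automorphic.Liu2021.AppendixC.IsogenyDescentOfLevelQuotient
import Literature.AlgebraicGeometry.ShimuraVarieties.UnitaryShimuraLevelQuotient
import Mathlib.CategoryTheory.Comma.Over.Pullback
import HarnessLib

/-!
# Input (D) `IsogenyDescent` of [Liu2021, Thm. 4.18 (1)] at the honest canonical-model tower, from the level quotient property
# of Deligne's models and the Albanese trace of a finite quotient (cell INVENTORY row VI-4 `HonestIsogenyDescent`: the
# Shimura-side bridge (S2) «`X_K = X_N/(K/N)`» and the final glue)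

[Liu2021] = Y. Liu, *Fourier–Jacobi cycles and arithmetic relative trace formula*, Camb. J. Math. 9 (2021); [Milne2005ShimuraVarieties]
J. S. Milne, *Introduction to Shimura varieties* (2005).  THEOREMS ONLY (no definition, no named fact, no instance, no `sorry`).
Cell hodgecm-mathlib (fan A rung A-III junction; seat B-p07), consumer: `stubLevelInvariants_of_atrEpi_of_isogenyDescent`
(`HypLiu418/A3Liu418LevelInvariants.lean`, p594701) whose binder `hD` is EXACTLY `isogenyDescent_heckeTranslatesFamilyOf` below
applied to `heckeTranslate_definedOver_holds` and `DelRec.exists_recordSystem_of_printed hDel`.  HC_CM is proved only modulo the 7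
printed citations until rung 0 closes; this file is conditional on two NAMED FACTS taken as hypotheses — the level quotient property
`levelQuotient_printed` of the models ([Milne2005ShimuraVarieties] Rem. 5.29 (c), [Deligne1979ShimuraVarieties] 2.7.1;
`ShimuraVarieties/UnitaryShimuraLevelQuotient.lean`, A-p12 p597637) and the Albanese trace of a finite quotient
`AlbaneseTraceOfFiniteQuotient` ([Lang1983AbelianVarieties] VIII §6; `Liu2021/AppendixC/AlbaneseFiniteQuotientTrace.lean`) — besides
the tree's `hU7`/`h` of the carriers.

## The chain

* §1 category theory: the universal property «quotient for a class of test objects by a family of endomorphisms» passes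
  (a) along a LEFT ADJOINT whose right adjoint preserves the test class (`quotUP_map_of_adjunction`: transpose, descend, transpose
  back) and (b) along conjugation by isomorphisms (`quotUP_conj`).
* §2 base change along the complex conjugation `c` of the CM field `F` is a self-equivalence of `SchemeOver F` (`c ∘ c = id`:
  `Over.pullbackComp`, `Over.pullbackId`), hence a left adjoint with right adjoint `baseChangeHom c`, which preserves separatedness
  (`exists_adjunction_baseChangeHom_cmConj`).
* §3 at the EXPLICIT honest carrier `sec42DataOfFourLe h V Φ h4 iso` (`X_K = M_K ⊗_{F,c} F`, translates = base-changed record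
  translates, `HComp/HeckeTranslatesOfRecord.lean`): `levelQuotient_printed` for the record `recordOf h V h4` ⟹ (§1 (b) along
  `recordFunctorOf_objIso`, then §1 (a) + §2) the transition `u^N_K` of the §4.2 datum is a quotient of `X_N` by the translates `T_k`
  (`k ∈ K`) for separated test objects (`sec42DataOfFourLe_levelQuotientUP`) ⟹ `IsogenyDescent` by the tree's
  `Sec42Data.HeckeTranslates.isogenyDescent_of_levelQuotient` (`isogenyDescent_sec42DataOfFourLe`).
* §4 transport to the TOTAL carrier `sec42DataOf` / `heckeTranslatesFamilyOf` along `sec42DataOf_eq_of_four_le` and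
  `sec42DataOf_heckeTranslates_heq` (`isogenyDescent_heckeTranslatesFamilyOf`).
-/

set_option autoImplicit false

noncomputable section

open CategoryTheory AlgebraicGeometry NumberField
open Literature.AlgebraicGeometry.Motives
open Literature.AlgebraicGeometry.ShimuraVarieties.UnitaryCanonicalModel
open Literature.NumberTheory.Automorphic
open Literature.NumberTheory.Automorphic.Liu2021
open Literature.NumberTheory.Automorphic.Liu2021.AppendixC
open Summit.HodgeConjecture.CorCM.HComp

namespace Summit.HodgeConjecture.CorCM.Model

/-! ## §1 Category theory: transporting the quotient universal property -/

section CategoryTheory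

universe v₁ v₂ u₁ u₂ w

variable {C : Type u₁} [Category.{v₁} C] {D : Type u₂} [Category.{v₂} D]

/-- **A left adjoint carries quotients to quotients** (for test classes matched by the right adjoint): if `p : Y ⟶ Z` is a
quotient of `Y` by the endomorphisms `t i` for the test objects in `PC` (every `t`-invariant `Y ⟶ W`, `PC W`, factors uniquely
through `p`), `F ⊣ G` and `G` maps `PD` into `PC`, then `F p` is a quotient of `F Y` by the `F (t i)` for the test objects in `PD`
(transpose along the adjunction, descend, transpose back). [folklore] -/
theorem quotUP_map_of_adjunction {F : C ⥤ D} {G : D ⥤ C} (adj : F ⊣ G) (PC : C → Prop) (PD : D → Prop)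
    (hGP : ∀ W, PD W → PC (G.obj W)) {ι : Type w} {Y Z : C} (t : ι → (Y ⟶ Y)) (p : Y ⟶ Z)
    (hp : ∀ (W : C) (f : Y ⟶ W), PC W → (∀ i, t i ≫ f = f) → ∃! fbar : Z ⟶ W, p ≫ fbar = f)
    (W : D) (f : F.obj Y ⟶ W) (hW : PD W) (hf : ∀ i, F.map (t i) ≫ f = f) :
    ∃! fbar : F.obj Z ⟶ W, F.map p ≫ fbar = f := by
  have hf' : ∀ i, t i ≫ adj.homEquiv Y W f = adj.homEquiv Y W f := fun i => by
    rw [← adj.homEquiv_naturality_left, hf i]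
  obtain ⟨fbar, hfbar, huniq⟩ := hp (G.obj W) (adj.homEquiv Y W f) (hGP W hW) hf'
  refine ⟨(adj.homEquiv Z W).symm fbar, ?_, fun g hg => ?_⟩
  · change F.map p ≫ (adj.homEquiv Z W).symm fbar = f
    rw [← adj.homEquiv_naturality_left_symm, hfbar, Equiv.symm_apply_apply]
  · apply (adj.homEquiv Z W).injective
    rw [Equiv.apply_symm_apply]
    have hg' : F.map p ≫ g = f := hg
    refine huniq _ ?_
    show p ≫ adj.homEquiv Z W g = adj.homEquiv Y W f
    rw [← adj.homEquiv_naturality_left, hg']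

/-- **Conjugation by isomorphisms preserves quotients**: if `p : Y ⟶ Z` is a quotient of `Y` by the `t i` for the test objects
in `P`, then `eY⁻¹ ≫ p ≫ eZ` is a quotient of `Y'` by the `eY⁻¹ ≫ t i ≫ eY` (`eY : Y ≅ Y'`, `eZ : Z ≅ Z'`). [folklore] -/
theorem quotUP_conj (P : C → Prop) {ι : Type w} {Y Y' Z Z' : C} (eY : Y ≅ Y') (eZ : Z ≅ Z') (t : ι → (Y ⟶ Y))
    (p : Y ⟶ Z) (hp : ∀ (W : C) (f : Y ⟶ W), P W → (∀ i, t i ≫ f = f) → ∃! fbar : Z ⟶ W, p ≫ fbar = f)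
    (W : C) (f : Y' ⟶ W) (hW : P W) (hf : ∀ i, (eY.inv ≫ t i ≫ eY.hom) ≫ f = f) :
    ∃! fbar : Z' ⟶ W, (eY.inv ≫ p ≫ eZ.hom) ≫ fbar = f := by
  have hf' : ∀ i, t i ≫ (eY.hom ≫ f) = eY.hom ≫ f := fun i => by
    have h1 := hf i
    simp only [Category.assoc] at h1
    have h2 := congrArg (fun x => eY.hom ≫ x) h1
    simpa only [Iso.hom_inv_id_assoc] using h2
  obtain ⟨fbar, hfbar, huniq⟩ := hp W (eY.hom ≫ f) hW hf'
  refine ⟨eZ.inv ≫ fbar, ?_, fun g hg => ?_⟩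
  · change (eY.inv ≫ p ≫ eZ.hom) ≫ eZ.inv ≫ fbar = f
    simp only [Category.assoc, Iso.hom_inv_id_assoc]
    rw [hfbar, Iso.inv_hom_id_assoc]
  · have h1 : p ≫ (eZ.hom ≫ g) = eY.hom ≫ f := by
      rw [← hg]
      simp only [Category.assoc, Iso.hom_inv_id_assoc]
    rw [← huniq _ h1, Iso.inv_hom_id_assoc]

end CategoryTheory

/-! ## §2 Base change along the complex conjugation of a CM field is a self-equivalence, hence a left adjoint -/

/-- **`(– ⊗_{F,c} F) ⊣ (– ⊗_{F,c} F)`**: base change along the complex conjugation `c` of the CM field `F` is an involutive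
self-equivalence of `SchemeOver F` (`c ∘ c = id`, so `Spec c ≫ Spec c = 𝟙` and
`baseChangeHom c ⋙ baseChangeHom c ≅ Over.pullback 𝟙 ≅ 𝟭`, Mathlib `Over.pullbackComp`, `Over.pullbackId`), in particular
(its adjointified form) an adjunction `baseChangeHom c ⊣ baseChangeHom c`. [folklore] -/
theorem exists_adjunction_baseChangeHom_cmConj (F : Type) [Field F] [NumberField F] [IsCMField F] :
    Nonempty (baseChangeHom (cmConjRingHom F) ⊣ baseChangeHom (cmConjRingHom F)) := by
  let s : Spec (CommRingCat.of F) ⟶ Spec (CommRingCat.of F) := Spec.map (CommRingCat.ofHom (cmConjRingHom F))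
  have hc : (cmConjRingHom F).comp (cmConjRingHom F) = RingHom.id F :=
    RingHom.ext fun x => IsCMField.complexConj_apply_apply F x
  have hs : s ≫ s = 𝟙 _ := by
    change Spec.map _ ≫ Spec.map _ = _
    rw [← Spec.map_comp, ← CommRingCat.ofHom_comp, hc, CommRingCat.ofHom_id, Spec.map_id]
  have key : ∀ f : Spec (CommRingCat.of F) ⟶ Spec (CommRingCat.of F), f = 𝟙 _ →
      Nonempty (Over.pullback f ≅ 𝟭 (SchemeOver F)) := by
    rintro f rfl
    exact ⟨Over.pullbackId⟩
  obtain ⟨e0⟩ := key (s ≫ s) hs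
  let η : 𝟭 (SchemeOver F) ≅ baseChangeHom (cmConjRingHom F) ⋙ baseChangeHom (cmConjRingHom F) :=
    e0.symm ≪≫ Over.pullbackComp s s
  let e : SchemeOver F ≌ SchemeOver F :=
    CategoryTheory.Equivalence.mk (baseChangeHom (cmConjRingHom F)) (baseChangeHom (cmConjRingHom F)) η η.symm
  exact ⟨e.toAdjunction⟩

/-- Base change preserves separatedness of the structure morphism (Mathlib: `IsSeparated` is stable under base change).
[folklore] -/
theorem isSeparated_baseChangeHom_obj {F L : Type} [Field F] [Field L] (σ : F →+* L) (W : SchemeOver F)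
    (hW : IsSeparated W.hom) : IsSeparated ((baseChangeHom σ).obj W).hom := by
  haveI := hW
  change IsSeparated (Limits.pullback.snd W.hom (Spec.map (CommRingCat.ofHom σ)))
  infer_instance

/-! ## §3 The level quotient property at the explicit honest carrier `sec42DataOfFourLe` ⟹ `IsogenyDescent` -/

section FourLe

variable {F : CMField} {ι₁ : F →+* ℂ}

/-- **(S2) at the honest tower, explicit carrier**: granted the level quotient property of the models
(`levelQuotient_printed`, [Milne2005ShimuraVarieties] Rem. 5.29 (c)), for sufficiently small levels `N ≤ K ≤ K_f(3)` with `N`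
normal in `K` the transition morphism `u^N_K : X_N ⟶ X_K` of the §4.2 datum `sec42DataOfFourLe h V Φ h4 iso`
(`X_K = Sh(𝕍)_K = M_K ⊗_{F,c} F`) is a QUOTIENT of `X_N` by the Hecke translates `T_k`, `k ∈ K` (the base-changed record
translates, `sec42DataOfFourLe_heckeTranslates`), for separated test objects.  Record level (`RecordSystem.IsLevelQuotient` for
`recordOf h V h4`, every translate being THE chosen one by `heckeTranslate_unique`) ⟶ conjugation by `recordFunctorOf_objIso`
(§1 (b)) ⟶ base change along `c` (§1 (a) + §2). [cite: Milne2005ShimuraVarieties, Rem. 5.29 (c) p. 65 and Thm. 13.6 p. 118]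
[cite: Liu2021, §4.2 l. 2062–2074 and Prop. C.5 l. 4627–4633] -/
theorem sec42DataOfFourLe_levelQuotientUP (hQ : levelQuotient_printed) (hU7 : heckeTranslate_definedOver)
    (h : exists_recordSystem) (V : HermSpace3 F ι₁) (Φ : Literature.AlgebraicGeometry.Motives.CMType F)
    (h4 : 4 ≤ Module.finrank ℚ F) (iso : ℕ → Prop)
    ⦃N K : C5.SmallLevel (K3 V)⦄ (hNK : N ≤ K) (hn : ∀ k ∈ K.1.1, C5.HeckeLE k N N)
    (W : SchemeOver F) (f : (sec42DataOfFourLe h V Φ h4 iso).X N ⟶ W) (hW : IsSeparated W.hom)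
    (hf : ∀ (k : ↥V.adelicFin) (hk : k ∈ K.1.1),
      (sec42DataOfFourLe_heckeTranslates hU7 h V Φ h4 iso).tr k N N (hn k hk) ≫ f = f) :
    ∃! fbar : (sec42DataOfFourLe h V Φ h4 iso).X K ⟶ W,
      (sec42DataOfFourLe h V Φ h4 iso).cpt.X.map (homOfLE hNK) ≫ fbar = f := by
  -- (0) the level quotient property of the chosen record system
  have hLQ : (recordOf h V h4).IsLevelQuotient :=
    hQ F V.Hm ι₁ (frameOf V) (formCongr_frameOf V) V.posDef_of_ne (V.anisotropic_of_four_le h4) (K3 V)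
      (torsionFree_arithmeticLevel_conj_K3 V) (recordOf h V h4)
  -- (1) record level, for the family of the CHOSEN translates `T_k`, `k ∈ K`
  let t : ↥K.1.1 → ((recordOf h V h4).M.obj N ⟶ (recordOf h V h4).M.obj N) := fun k =>
    recordHeckeTranslate hU7 h V h4 (k : ↥V.adelicFin) N N (hn k k.2)
  obtain ⟨act, hact, hsep⟩ := hLQ hNK (fun k hk n hn' => hn k hk n hn')
  have h1 : ∀ (W : SchemeOver F) (f : (recordOf h V h4).M.obj N ⟶ W), IsSeparated W.hom → (∀ i, t i ≫ f = f) →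
      ∃! fbar : (recordOf h V h4).M.obj K ⟶ W, (recordOf h V h4).M.map (homOfLE hNK) ≫ fbar = f := by
    intro W f hW hf
    refine hsep.2 W f hW fun k => ?_
    have hk' : ((k : ↥V.adelicFin)⁻¹) ∈ K.1.1 := K.1.1.inv_mem k.2
    rw [(recordOf h V h4).heckeTranslate_unique (hact k)
      (isHeckeTranslate_recordHeckeTranslate hU7 h V h4 ((k : ↥V.adelicFin)⁻¹) N N (hn _ hk'))]
    exact hf ⟨(k : ↥V.adelicFin)⁻¹, hk'⟩
  -- (2) conjugate by `recordFunctorOf_objIso` (the total record functor)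
  have h2 := quotUP_conj (fun W : SchemeOver F => IsSeparated W.hom) (recordFunctorOf_objIso h V h4 N).symm
    (recordFunctorOf_objIso h V h4 K).symm t ((recordOf h V h4).M.map (homOfLE hNK)) h1
  have hp' : (recordFunctorOf_objIso h V h4 N).symm.inv ≫ (recordOf h V h4).M.map (homOfLE hNK) ≫
      (recordFunctorOf_objIso h V h4 K).symm.hom = (recordFunctorOf h V).map (homOfLE hNK) := by
    rw [Iso.symm_inv, Iso.symm_hom, ← recordFunctorHeckeTranslate_one hU7 h V h4 (homOfLE hNK), recordFunctorHeckeTranslate,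
      recordHeckeTranslate_one]
  have ht' : ∀ i : ↥K.1.1, (recordFunctorOf_objIso h V h4 N).symm.inv ≫ t i ≫ (recordFunctorOf_objIso h V h4 N).symm.hom =
      recordFunctorHeckeTranslate hU7 h V h4 (i : ↥V.adelicFin) N N (hn i i.2) := fun i => by
    rw [Iso.symm_inv, Iso.symm_hom]
    rfl
  -- (3) base change along `c`
  obtain ⟨adj⟩ := exists_adjunction_baseChangeHom_cmConj (F : Type)
  have h3 := quotUP_map_of_adjunction adj (fun W : SchemeOver F => IsSeparated W.hom)
    (fun W : SchemeOver F => IsSeparated W.hom) (fun W hW => isSeparated_baseChangeHom_obj _ W hW)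
    (fun i : ↥K.1.1 => (recordFunctorOf_objIso h V h4 N).symm.inv ≫ t i ≫ (recordFunctorOf_objIso h V h4 N).symm.hom)
    ((recordFunctorOf_objIso h V h4 N).symm.inv ≫ (recordOf h V h4).M.map (homOfLE hNK) ≫
      (recordFunctorOf_objIso h V h4 K).symm.hom) h2 W f hW (fun i => by
      rw [ht' i]
      exact hf i i.2)
  rw [hp'] at h3
  exact h3

/-- **Input (D) `IsogenyDescent` at the explicit honest carrier** `sec42DataOfFourLe h V Φ h4 iso` with its Hecke translates,
granted `levelQuotient_printed` and `AlbaneseTraceOfFiniteQuotient`: `K/N`-invariant homomorphisms on `Alb(X_N)` descend to `Alb(X_K)`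
up to the non-zero integer `[K:N]` (the tree's `Sec42Data.HeckeTranslates.isogenyDescent_of_levelQuotient`).
[cite: Liu2021, Thm. 4.18 (1) FJcycle.tex l. 2239 and §4.2 l. 2064–2074] [cite: Lang1983AbelianVarieties, Ch. VIII §6 Thm. 13, pp. 224–227] -/
theorem isogenyDescent_sec42DataOfFourLe (hQ : levelQuotient_printed) (hAT : AlbaneseTraceOfFiniteQuotient.{0})
    (hU7 : heckeTranslate_definedOver) (h : exists_recordSystem) (V : HermSpace3 F ι₁)
    (Φ : Literature.AlgebraicGeometry.Motives.CMType F) (h4 : 4 ≤ Module.finrank ℚ F) (iso : ℕ → Prop) :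
    (sec42DataOfFourLe_heckeTranslates hU7 h V Φ h4 iso).IsogenyDescent :=
  Sec42Data.HeckeTranslates.isogenyDescent_of_levelQuotient _ hAT
    (fun _ _ hNK hn W f hW hf => sec42DataOfFourLe_levelQuotientUP hQ hU7 h V Φ h4 iso hNK hn W f hW hf)

end FourLe

/-! ## §4 Transport to the total carrier `sec42DataOf` / `heckeTranslatesFamilyOf` -/

section Total

variable {F₀ E₀ : Type} [Field F₀] [NumberField F₀] [IsTotallyReal F₀] [Field E₀] [NumberField E₀] [Algebra F₀ E₀]
  [IsTotallyComplex E₀] [Algebra.IsQuadraticExtension F₀ E₀] {P5 : PropC5Data F₀ E₀} {isotropicAt : ℕ → Prop}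

/-- `IsogenyDescent` is invariant under propositional equality of the carrier and heterogeneous equality of the translates
(bookkeeping for the `dif_pos` transport `sec42DataOf_eq_of_four_le`). [folklore] -/
theorem isogenyDescent_of_heq {C C' : Sec42Data P5 isotropicAt} (e : C = C') {T : C.HeckeTranslates}
    {T' : C'.HeckeTranslates} (hT : HEq T T') (hd : T'.IsogenyDescent) : T.IsogenyDescent := by
  subst e
  cases hT
  exact hd

end Total

/-- **Input (D) of [Liu2021, Thm. 4.18 (1)] for the honest canonical-model tower (row VI-4 `HonestIsogenyDescent`)**: granted the
level quotient property of Deligne's models ([Milne2005ShimuraVarieties] Rem. 5.29 (c)) and the Albanese trace of a finite quotient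
([Lang1983AbelianVarieties] VIII §6), the Hecke translates `heckeTranslatesFamilyOf hU7 h iso F ι₁ V Φ h6` on the §4.2 datum
`sec42DataOf h iso F ι₁ V Φ` satisfy `IsogenyDescent`: for `N ≤ K` sufficiently small with `N` normal in `K`, every homomorphism
`φ : A_N ⟶ B` with `Alb(T_k) ≫ φ = φ` (`k ∈ K`) has `Alb_{u^N_K} ≫ ψ = m • φ` for some `ψ : A_K ⟶ B`, `m ≠ 0`.  This is the binder
`hD` of `Lines.A3Liu418.stubLevelInvariants_of_atrEpi_of_isogenyDescent` at `hU7 := heckeTranslate_definedOver_holds`,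
`h := DelRec.exists_recordSystem_of_printed hDel`, `iso := isoOf`. [cite: Liu2021, Thm. 4.18 (1) FJcycle.tex l. 2239, §4.2 l. 2064–2074]
[cite: Milne2005ShimuraVarieties, Rem. 5.29 (c) p. 65] [cite: Lang1983AbelianVarieties, Ch. VIII §6 Thm. 13, pp. 224–227] -/
theorem isogenyDescent_heckeTranslatesFamilyOf (hQ : levelQuotient_printed) (hAT : AlbaneseTraceOfFiniteQuotient.{0})
    (hU7 : heckeTranslate_definedOver) (h : exists_recordSystem)
    (iso : ∀ (F : CMField) (ι₁ : F →+* ℂ) (_ : HermSpace3 F ι₁) (_ : Literature.AlgebraicGeometry.Motives.CMType F), ℕ → Prop)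
    {F : CMField} {ι₁ : F →+* ℂ} (V : HermSpace3 F ι₁) (Φ : Literature.AlgebraicGeometry.Motives.CMType F)
    (h6 : 6 ≤ Module.finrank ℚ F) :
    (heckeTranslatesFamilyOf hU7 h iso F ι₁ V Φ h6).IsogenyDescent :=
  isogenyDescent_of_heq (sec42DataOf_eq_of_four_le h V Φ iso (le_trans (by norm_num) h6))
    (sec42DataOf_heckeTranslates_heq hU7 h V Φ iso (le_trans (by norm_num) h6))
    (isogenyDescent_sec42DataOfFourLe hQ hAT hU7 h V Φ (le_trans (by norm_num) h6) (iso F ι₁ V Φ))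

/-! ## §5 The same with the Albanese trace AT THE FIELD `F` ONLY (re-threading to the currency `k ⊂ ℂ` in which (T) is proved) -/

section Trace

variable {F : CMField} {ι₁ : F →+* ℂ}

/-- **Input (D) at the explicit honest carrier, granted the level quotient property and the Albanese trace over `F` only**:
the same as `isogenyDescent_sec42DataOfFourLe`, with the universally quantified named fact `AlbaneseTraceOfFiniteQuotient.{0}`
replaced by its instance at the CM field `F` of the datum (the tree's `Sec42Data.HeckeTranslates.isogenyDescent_of_levelQuotient_of_trace`).
Re-threading only. [cite: Liu2021, Thm. 4.18 (1) FJcycle.tex l. 2239 and §4.2 l. 2064–2074] [cite: Lang1983AbelianVarieties, Ch. VIII §6 Thm. 13, pp. 224–227] -/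
theorem isogenyDescent_sec42DataOfFourLe_of_trace (hQ : levelQuotient_printed)
    (hAT : ∀ (X Y : SchemeOver F) (dX dY : ℕ)
      [SmoothOfRelativeDimension dX X.hom] [SmoothOfRelativeDimension dY Y.hom],
      IsProjectiveOver X → IsProjectiveOver Y →
      ∀ (Δ : Type) [Group Δ] [Fintype Δ] (act : Δ →* Aut X) (p : X ⟶ Y),
        IsSepQuotient (fun g => act g) p →
        ∀ (aX : Albanese X) (aY : Albanese Y),
          ∃ t : aY.Alb ⟶ aX.Alb, aX.map aY p ≫ t = ∑ g : Δ, aX.map aX (act g).hom)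
    (hU7 : heckeTranslate_definedOver) (h : exists_recordSystem) (V : HermSpace3 F ι₁)
    (Φ : Literature.AlgebraicGeometry.Motives.CMType F) (h4 : 4 ≤ Module.finrank ℚ F) (iso : ℕ → Prop) :
    (sec42DataOfFourLe_heckeTranslates hU7 h V Φ h4 iso).IsogenyDescent :=
  Sec42Data.HeckeTranslates.isogenyDescent_of_levelQuotient_of_trace _ hAT
    (fun _ _ hNK hn W f hW hf => sec42DataOfFourLe_levelQuotientUP hQ hU7 h V Φ h4 iso hNK hn W f hW hf)

/-- **Input (D) for the honest canonical-model tower, granted the level quotient property and the Albanese trace over `F` only**: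
the same as `isogenyDescent_heckeTranslatesFamilyOf` with `AlbaneseTraceOfFiniteQuotient.{0}` replaced by its instance at `F` — the
shape in which the trace is PROVED for fields `k ⊂ ℂ` (cocycle + `∇`-descent chain; row VI-5).  Re-threading only.
[cite: Liu2021, Thm. 4.18 (1) FJcycle.tex l. 2239, §4.2 l. 2064–2074] [cite: Milne2005ShimuraVarieties, Rem. 5.29 (c) p. 65]
[cite: Lang1983AbelianVarieties, Ch. VIII §6 Thm. 13, pp. 224–227] -/
theorem isogenyDescent_heckeTranslatesFamilyOf_of_trace (hQ : levelQuotient_printed)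
    (hAT : ∀ (X Y : SchemeOver F) (dX dY : ℕ)
      [SmoothOfRelativeDimension dX X.hom] [SmoothOfRelativeDimension dY Y.hom],
      IsProjectiveOver X → IsProjectiveOver Y →
      ∀ (Δ : Type) [Group Δ] [Fintype Δ] (act : Δ →* Aut X) (p : X ⟶ Y),
        IsSepQuotient (fun g => act g) p →
        ∀ (aX : Albanese X) (aY : Albanese Y),
          ∃ t : aY.Alb ⟶ aX.Alb, aX.map aY p ≫ t = ∑ g : Δ, aX.map aX (act g).hom)
    (hU7 : heckeTranslate_definedOver) (h : exists_recordSystem)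
    (iso : ∀ (F : CMField) (ι₁ : F →+* ℂ) (_ : HermSpace3 F ι₁) (_ : Literature.AlgebraicGeometry.Motives.CMType F), ℕ → Prop)
    (V : HermSpace3 F ι₁) (Φ : Literature.AlgebraicGeometry.Motives.CMType F) (h6 : 6 ≤ Module.finrank ℚ F) :
    (heckeTranslatesFamilyOf hU7 h iso F ι₁ V Φ h6).IsogenyDescent :=
  isogenyDescent_of_heq (sec42DataOf_eq_of_four_le h V Φ iso (le_trans (by norm_num) h6))
    (sec42DataOf_heckeTranslates_heq hU7 h V Φ iso (le_trans (by norm_num) h6))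
    (isogenyDescent_sec42DataOfFourLe_of_trace hQ hAT hU7 h V Φ (le_trans (by norm_num) h6) (iso F ι₁ V Φ))

end Trace

end Summit.HodgeConjecture.CorCM.Model

end
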